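import Summits.HodgeConjecture.CorCM.MultiFieldWeilDihedralUnit
import Summits.HodgeConjecture.CorCM.MultiFieldWeilUnitsMenu
import HarnessLib

/-!
# MULTI-FIELD WEIL ENGINE — DIHEDRAL DECIC FIELDS ENTER THE MENU: `E` + up to TWO fivefolds of `k`-signature `(2,3)` over each of several decic CM fields through `k` whose
# quintic part is DIHEDRAL (Galois closure of degree `20`), the two types free of common symmetries — the Hodge conjecture for every product of copies, given only
# Markman's hyperbolic-sixfold theorem

Cell `pub-hodgecm2` (COR-CM), seat b30 gen 42 (2026-08-26); count-neutral own lane MULTI-FIELD WEIL ENGINE (stem `MultiFieldWeil*`), the geometric dress of the DIHEDRAL PENTAGON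
(`…DihedralFive`, `…DihedralFiveCriterion`, `…DihedralImage`, `…DihedralUnit`) through the defect law with SEPARATED units (`…UnitsSeparated`), written as the decic section of
`CorCM/MultiFieldWeilUnitsMenu.lean` (U: several isogeny classes per field) with the `2`-transitivity hypothesis «two `τ`-embeddings generating degree `40`» REPLACED by dihedral
data.  Theorems only; no definition, no named fact, no `sorry`.  HONEST FRAMING: conditional ONLY on the displayed Markman binder `hM6`; `HC_CM` is NOT proved and not asserted.

**`hodgeConjectureFor_biproduct_comp_of_dihedralDecics`.**  Slots `is : Fin r → I` over DECIC CM fields `Kf i ⊇ iK i (k)`, `k = Kf i₀` imaginary quadratic, `E = A 0 ⊨ (k; {τ})`,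
`B_m = A (m+1) ⊨ (K_{is m}; Φ (m+1))` with EXACTLY TWO members of `Φ (m+1)` over `τ` (`k`-signature `(2,3)`); slots with the same index are structures over the same field.
HYPOTHESES, per field `K = K_{is m}`: at most `2` slots; the Galois closure `L(K) ⊂ ℂ` has degree `≤ 20` and some `τ`-embedding takes a value outside the image of another
(`K = k·K⁺` with `K⁺` a real quintic field of DIHEDRAL Galois group — NOT `2`-transitive on the five `τ`-embeddings, so NO earlier menu applies); FREENESS: an automorphism of
`ℂ` over `τ(k)` that stabilises, on the `τ`-embeddings, the type of every structure over `K` fixes every `τ`-embedding of `K` (for two types `{a, b} ≠ {a', b'}` read on the pentagon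
of `τ`-embeddings: different axes, `a + b ≠ a' + b'` — e.g. the two types SHARE a `τ`-embedding; for one type: automatic); `Hom(K_i, K_{i'}) = ∅` for different indices.  THEN the
Hodge conjecture holds for EVERY product of copies `⨁_j A(κ j)`, GIVEN ONLY Markman's hyperbolic-sixfold theorem.  NOT covered, honestly: two types with a COMMON axis (the `5`
pairs {edge, disjoint diagonal} — genuinely dependent, `…CommutantNoGo`), three classes over one dihedral field (`dim_{ℚ(√5)} = 2`), cyclic quintic parts (one class only, ibid.).

PROOF.  One sign frame per index; units = fibres of `is`, realised tuples diagonal on units; the separation property of each unit with two slots is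
`const_of_signed_realisedTuples_of_dihedral` (image of order `10` from `[L(K):ℚ] ≤ 20`, a non-identity element with a fixed letter from the outside value, hence a dihedral image;
freeness ⟹ different axes ⟹ `ℚ(√5)`-independence ⟹ separation); single slots are prime slots; stabiliser-transitivity across fields from `Hom = ∅` (a value outside the closure,
prime size); `hodgeConjectureFor_biproduct_comp_of_unitsSeparated_frames` + Markman's sixfold theorem for the single-slot Weil spaces.

[cite: Markman2025SecantWeil, Thm 1.5.1] [cite: Shimura1998, §6.1 Corollary of Theorem 2, §8.4, §18.2 Lemma (i)] [cite: Deligne1982HodgeCycles, §5 (b)] [cite: Lang2002, VI §1 Thm. 1.1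
and V §2 Thm. 2.8; XIII §4] [cite: MoonenZarhin1995Duke, Thm. 2.4] [cite: Pohlmann1968, Thm 1] [cite: DixonMortimer1996, §1.4 Ex. 1.4.1–1.4.2; §1.6, Thm. 1.6A; §2.1; §3.3]
[cite: Serre1977, §5.3] [cite: MumfordAV1970, §19]

## References
* [Markman2025SecantWeil] E. Markman, Cycles on abelian 2n-folds of Weil type from secant sheaves on abelian n-folds, Thm 1.5.1.  [Shimura1998] G. Shimura, *Abelian varieties with
  complex multiplication and modular functions*, §6.1, §8.4, §18.2.  [Deligne1982HodgeCycles] P. Deligne, LNM 900, §5 (b).  [Lang2002] S. Lang, *Algebra*, GTM 211, V §2, VI §1,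
  XIII §4.  [MoonenZarhin1995Duke] B. Moonen, Yu. Zarhin, Duke Math. J. 77 (1995), Thm. 2.4.  [Pohlmann1968] H. Pohlmann, Ann. of Math. 88 (1968), Thm 1.  [DixonMortimer1996]
  J. D. Dixon, B. Mortimer, *Permutation Groups*, GTM 163.  [Serre1977] J.-P. Serre, *Linear Representations of Finite Groups*, GTM 42, §5.3.  [MumfordAV1970] D. Mumford,
  *Abelian Varieties*, §19.
-/

noncomputable section

open CategoryTheory CategoryTheory.Limits NumberField IntermediateField

namespace Summit.HodgeConjecture.CorCM.MultiFieldWeil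

open Finset
open Literature.AlgebraicGeometry Literature.AlgebraicGeometry.Motives Literature.AlgebraicGeometry.HodgeTheory
open Literature.AlgebraicGeometry.ComplexMultiplication (IsCMTypeRealisation)
open Literature.AlgebraicTopology.SingularHomology
open Literature.NumberTheory.ComplexMultiplication
open Summit.HodgeConjecture.CorCM.Census.MultiFieldWeil

open scoped Classical

/-! ## The menu over dihedral decic fields -/

section DihedralDecics

variable {I : Type} {r : ℕ} {Kf : I → Type} [∀ i, Field (Kf i)] [∀ i, NumberField (Kf i)] [∀ i, IsCMField (Kf i)]
  {i₀ : I} {is : Fin r → I} {τ : Kf i₀ →+* ℂ}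
  {A : Fin (r + 1) → AbelianVariety ℂ} {Φ : ∀ j : Fin (r + 1), CMType (Kf (mfSlots i₀ is j))}
  {ι : ∀ j, 𝓞 (Kf (mfSlots i₀ is j)) →+* End (A j)}
  {θ : ∀ j, Kf (mfSlots i₀ is j) →+* Module.End ℂ (complexBetti (A j).X 1)}

/-- **UP TO TWO `(2,3)`-FIVEFOLDS OVER EACH OF SEVERAL DIHEDRAL DECIC CM FIELDS THROUGH `k`, TIMES THE CM CURVE — GIVEN ONLY MARKMAN'S HYPERBOLIC-SIXFOLD THEOREM.**
See the module docstring.  `HC_CM` is NOT asserted. [cite: Markman2025SecantWeil, Thm 1.5.1] [cite: Shimura1998, §6.1 Corollary of Theorem 2, §8.4, §18.2]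
[cite: DixonMortimer1996, §1.4 Ex. 1.4.1–1.4.2; §1.6, Thm. 1.6A; §2.1; §3.3] [cite: Serre1977, §5.3] [cite: Lang2002, VI §1 Thm. 1.1; XIII §4] -/
theorem hodgeConjectureFor_biproduct_comp_of_dihedralDecics (hM6 : Markman2025_weilClasses_algebraic_hyperbolicSixfold)
    {N : ℕ} (κ : Fin N → Fin (r + 1)) (h2 : Module.finrank ℚ (Kf i₀) = 2)
    (hdeg : ∀ m : Fin r, Module.finrank ℚ (Kf (is m)) = 10) (iK : ∀ i : I, Kf i₀ →+* Kf i)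
    (hA : ∀ j, IsCMTypeRealisation (Φ j) (A j) (ι j) (θ j)) (hΨ : ∀ σ : Kf i₀ →+* ℂ, σ ∈ (Φ 0).1 ↔ σ = τ)
    (h23 : ∀ m : Fin r, (Finset.univ.filter fun s : Kf (is m) →+* ℂ => s.comp (iK (is m)) = τ ∧ s ∈ (Φ m.succ).1).card = 2)
    (hfib : ∀ m : Fin r, (Finset.univ.filter fun m' : Fin r => is m' = is m).card ≤ 2)
    (h20 : ∀ m : Fin r, Module.finrank ℚ ↥(normalClosure ℚ (Kf (is m)) ℂ) ≤ 20)
    (hns : ∀ m : Fin r, ∃ s₀ t₀ : Kf (is m) →+* ℂ, s₀.comp (iK (is m)) = τ ∧ t₀.comp (iK (is m)) = τ ∧ ∃ x, t₀ x ∉ adjoin ℚ (Set.range s₀))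
    (hfree : ∀ (m : Fin r) (ρ : ℂ ≃+* ℂ), (ρ : ℂ →+* ℂ).comp τ = τ →
      (∀ m', is m' = is m → ∀ s : Kf (is m') →+* ℂ, s.comp (iK (is m')) = τ → (s ∈ (Φ m'.succ).1 ↔ (ρ : ℂ →+* ℂ).comp s ∈ (Φ m'.succ).1)) →
      ∀ s : Kf (is m) →+* ℂ, s.comp (iK (is m)) = τ → (ρ : ℂ →+* ℂ).comp s = s)
    (hiso : ∀ m₀ m : Fin r, is m ≠ is m₀ → IsEmpty (Kf (is m) →+* Kf (is m₀))) :
    HodgeConjectureFor (⨁ fun j => A (κ j)).dim (⨁ fun j => A (κ j)).X := by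
  have hττ : ComplexEmbedding.conjugate τ ≠ τ := QuarticCM.conjugate_ne τ
  have hk : ∀ σ : Kf i₀ →+* ℂ, σ = τ ∨ σ = ComplexEmbedding.conjugate τ := fun σ => QuarticCM.eq_or_eq_conjugate_of_quadratic h2 τ σ
  obtain ⟨δ₀, d, hd, hδ₀⟩ := CyclicSextic.exists_sq_eq_neg_nat_of_isTotallyComplex (Kf i₀) h2
  obtain ⟨δ, hδ, hτ⟩ := OcticCurveFourfold.exists_delta_of_mem h2 hd hδ₀ τ
  let im : ∀ m : Fin r, Kf i₀ →+* Kf (is m) := fun m => iK (is m)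
  have hdeg' : ∀ m : Fin r, Module.finrank ℚ (Kf (is m)) = 2 * 5 := fun m => by rw [hdeg m]
  -- (1) the units: a representative map for the fibres of `is`
  obtain ⟨U, hU⟩ := exists_unitRep is
  have hcardU : ∀ m, Fintype.card {m' : Fin r // U m' = U m} = (Finset.univ.filter fun m' : Fin r => is m' = is m).card := fun m => by
    rw [Fintype.card_subtype]; exact congrArg Finset.card (Finset.ext fun x => by simp only [Finset.mem_filter, Finset.mem_univ, true_and, hU])
  -- (2) ONE SIGN FRAME PER INDEX
  have hfr : ∀ i : I, Module.finrank ℚ (Kf i) = 2 * 5 → ∃ E : (Kf i →+* ℂ) ≃ Fin 5 × Bool,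
      (∀ s, (E s).2 = true ↔ s.comp (iK i) = τ) ∧ ∀ s, E (ComplexEmbedding.conjugate s) = ((E s).1, !(E s).2) := fun i hdi => exists_signFrame hdi h2 (iK i) hττ hk
  choose E hE_sign hE_conj using hfr
  have diagT : ∀ i j : I, ∀ h : i = j, ∀ (hi : Module.finrank ℚ (Kf i) = 2 * 5) (hj : Module.finrank ℚ (Kf j) = 2 * 5) (ρ : ℂ →+* ℂ) (a x y : Fin 5),
      ρ.comp ((E i hi).symm (a, true)) = (E i hi).symm (x, true) → ρ.comp ((E j hj).symm (a, true)) = (E j hj).symm (y, true) → x = y := by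
    intro i j h; subst h; intro hi hj ρ a x y h₁ h₂
    exact congrArg Prod.fst ((E i hi).symm.injective (h₁.symm.trans h₂))
  -- (3) the frames of the slots, their readings and position sets (all of size `5`)
  let e : ∀ m : Fin r, (Kf (is m) →+* ℂ) ≃ Fin 5 × Bool := fun m => E (is m) (hdeg' m)
  have he_sign : ∀ (m : Fin r) (s : Kf (is m) →+* ℂ), (e m s).2 = true ↔ s.comp (im m) = τ := fun m => hE_sign (is m) (hdeg' m)
  have he_conj : ∀ (m : Fin r) (s : Kf (is m) →+* ℂ), e m (ComplexEmbedding.conjugate s) = ((e m s).1, !(e m s).2) := fun m => hE_conj (is m) (hdeg' m)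
  let P : ∀ _ : Fin r, Finset (Fin 5) := fun m => Finset.univ.filter fun a : Fin 5 => (e m).symm (a, true) ∈ (Φ m.succ).1
  have hΦ : ∀ (m : Fin r) (s : Kf (is m) →+* ℂ), s ∈ (Φ m.succ).1 ↔ (e m s).2 = decide ((e m s).1 ∈ P m) := fun m s =>
    mem_iff_snd_eq_decide_mem_posSet (he_conj m) (Φ m.succ) s
  have hcard : ∀ m : Fin r, (P m).card = 2 := fun m => (card_posSet (he_sign m) (Φ m.succ)).trans (h23 m)
  have hmemP : ∀ (m : Fin r) (a : Fin 5), a ∈ P m ↔ (e m).symm (a, true) ∈ (Φ m.succ).1 := fun m a => by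
    simp only [P, Finset.mem_filter, Finset.mem_univ, true_and]
  have hsymm_sign : ∀ (m : Fin r) (a : Fin 5), ((e m).symm (a, true)).comp (im m) = τ := fun m a => (he_sign m _).1 (by simp)
  -- (4) the realised tuples are DIAGONAL on every unit
  have hn : ∀ m m' : Fin r, U m' = U m → (5 : ℕ) = 5 := fun _ _ _ => rfl
  have hdg0 : ∀ π ∈ realisedTuples e τ, ∀ (m m' : Fin r), U m' = U m → ∀ a : Fin 5, π m' a = π m a := by
    intro π hπ m m' h a; obtain ⟨ρ, -, hρ⟩ := (mem_realisedTuples e τ π).1 hπ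
    exact diagT _ _ ((hU m m').1 h) (hdeg' m') (hdeg' m) (ρ : ℂ →+* ℂ) a (π m' a) (π m a) (hρ m' a) (hρ m a)
  have hdg : ∀ π ∈ realisedTuples e τ, ∀ (m m' : Fin r) (h : U m' = U m) (a : Fin 5), Fin.cast (hn m m' h) (π m' a) = π m (Fin.cast (hn m m' h) a) := by
    intro π hπ m m' h a
    have e1 : Fin.cast (hn m m' h) (π m' a) = π m' a := Fin.ext rfl
    have e2 : Fin.cast (hn m m' h) a = a := Fin.ext rfl
    rw [e1, e2]; exact hdg0 π hπ m m' h a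
  -- (5) stabiliser-transitivity across units: `Hom = ∅` between different decic fields gives a value outside the closure; prime size `5`
  have hexs : ∀ m : Fin r, ∃ s : Kf (is m) →+* ℂ, s.comp (im m) = τ := fun m => by
    obtain ⟨s₀, -, hs₀, -, -⟩ := hns m; exact ⟨s₀, hs₀⟩
  have hout : ∀ m₀ m : Fin r, is m ≠ is m₀ → ∃ s : Kf (is m) →+* ℂ, s.comp (im m) = τ ∧ ∃ x, s x ∉ normalClosure ℚ (Kf (is m₀)) ℂ := by
    intro m₀ m hne; obtain ⟨s, hs⟩ := hexs m
    exact ⟨s, hs, exists_apply_not_mem_normalClosure_of_isEmpty_ringHom_five h2 im (hdeg m₀) (hdeg m) (hiso m₀ m hne) s hs⟩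
  have hstab₀ : ∀ (m₀ m : Fin r), is m ≠ is m₀ → ∀ a a' : Fin 5, ∃ ν ∈ realisedTuples e τ, ν m₀ = 1 ∧ ν m a = a' := fun m₀ m hne a a' =>
    stabTransitive_realisedTuples_of_outside_prime (e := e) he_sign m₀ m Nat.prime_five (hout m₀ m hne) a a'
  have hstab : ∀ (m₀ m : Fin r), U m₀ ≠ U m → ∀ a a' : Fin 5, ∃ ν ∈ realisedTuples e τ, (∀ m', U m' = U m₀ → ν m' = 1) ∧ ν m a = a' := by
    intro m₀ m hne a a'
    obtain ⟨ν, hν, hν0, hνa⟩ := hstab₀ m₀ m (fun h => hne ((hU m m₀).2 h.symm)) a a'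
    refine ⟨ν, hν, fun m' hm' => Equiv.ext fun b => ?_, hνa⟩
    have hb := hdg0 ν hν m₀ m' hm' b
    rw [hν0] at hb
    exact hb
  -- (6) the slot menu on the single slots: prime size
  have hkind : ∀ m : Fin r, (∀ m', U m' = U m → m' = m) → (5 : ℕ).Prime ∨ (2 : ℕ) = 1 ∨
      ∀ Q : Finset (Fin 5), Q.card = 2 → ∃ π ∈ realisedTuples e τ, preG (π m) (P m) = Q := fun m _ => Or.inl Nat.prime_five
  -- (7) THE SEPARATION PROPERTY OF EVERY UNIT WITH TWO SLOTS: the dihedral unit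
  have hunit : ∀ m, (∃ m', m' ≠ m ∧ U m' = U m) → ∀ (u : {m' : Fin r // U m' = U m} → Fin 5 → ℤ) (w : ℤ),
      (∀ π ∈ realisedTuples e τ, (∑ i, ∑ x : Fin 5, (if π m x ∈ (P i.1).image (Fin.cast (hn m i.1 i.2)) then u i x else -u i x)) = w) →
      ∀ (i : {m' : Fin r // U m' = U m}) (a b : Fin 5), u i a = u i b := by
    intro m _ u w hw
    have hix : ∀ x : {x : Fin r // U x = U m}, is x.1 = is m := fun x => (hU m x.1).1 x.2
    have hι : Fintype.card {m' : Fin r // U m' = U m} ≤ 2 := by rw [hcardU m]; exact hfib m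
    have hQcard : ∀ i : {m' : Fin r // U m' = U m}, ((P i.1).image (Fin.cast (hn m i.1 i.2))).card = 2 := fun i => by
      rw [Finset.card_image_of_injective _ (Fin.cast_injective _), hcard]
    have hmemQ : ∀ (i : {m' : Fin r // U m' = U m}) (y : Fin 5), y ∈ (P i.1).image (Fin.cast (hn m i.1 i.2)) ↔ y ∈ P i.1 := fun i y => by
      rw [image_cast_self]
    -- freeness, read on the realised tuples
    have hfreeR : ∀ π ∈ realisedTuples e τ, (∀ (i : {m' : Fin r // U m' = U m}) (y : Fin 5), π m y ∈ (P i.1).image (Fin.cast (hn m i.1 i.2)) ↔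
        y ∈ (P i.1).image (Fin.cast (hn m i.1 i.2))) → π m = 1 := by
      intro π hπ hst
      obtain ⟨ρ, hρτ, hρ⟩ := (mem_realisedTuples e τ π).1 hπ
      have hfix := hfree m ρ hρτ (fun m' hm' s hs => by
        have hUm' : U m' = U m := (hU m m').2 hm'
        set a : Fin 5 := (e m' s).1 with ha
        have hs' : (e m').symm (a, true) = s := by
          rw [ha, show ((e m' s).1, true) = e m' s from Prod.ext rfl ((he_sign m' s).2 hs).symm, Equiv.symm_apply_apply]
        have hρs : (ρ : ℂ →+* ℂ).comp s = (e m').symm (π m' a, true) := by rw [← hs']; exact hρ m' a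
        have h1 : s ∈ (Φ m'.succ).1 ↔ a ∈ P m' := by rw [hmemP, hs']
        have h2' : (ρ : ℂ →+* ℂ).comp s ∈ (Φ m'.succ).1 ↔ π m' a ∈ P m' := by rw [hmemP, hρs]
        rw [h1, h2']
        have := hst ⟨m', hUm'⟩ a
        rw [hmemQ, hmemQ, ← hdg0 π hπ m m' hUm' a] at this
        exact this.symm)
      refine Equiv.ext fun y => ?_
      have hy := hfix ((e m).symm (y, true)) (hsymm_sign m y)
      rw [hρ m y] at hy
      exact congrArg Prod.fst ((e m).symm.injective hy)
    exact const_of_signed_realisedTuples_of_dihedral (e := e) he_sign m rfl h2 (h20 m) (hns m) hι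
      (fun i => (P i.1).image (Fin.cast (hn m i.1 i.2))) hQcard hfreeR u hw
  -- (8) the engine with separated units; the single-slot Weil spaces from Markman's sixfold theorem
  exact hodgeConjectureFor_biproduct_comp_of_unitsSeparated_frames (is := is) (n := fun _ => 5) P (fun _ => 2) hcard (fun _ => by norm_num) (fun _ => by norm_num)
    κ h2 im hτ hA e he_sign he_conj hΨ hΦ U hn hdg hstab hunit hkind
    fun m => weilHyp_of_markman_sixfold_decic_intrinsic hM6 m (hdeg m) h2 hd hδ hA hΨ (h23 m)

/-- **Dominated form.** [cite: Markman2025SecantWeil, Thm 1.5.1] [cite: MumfordAV1970, §19 Thm. 1 and p. 169] -/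
theorem hodgeConjectureFor_of_avDominatedBy_comp_of_dihedralDecics (hM6 : Markman2025_weilClasses_algebraic_hyperbolicSixfold)
    {N : ℕ} (κ : Fin N → Fin (r + 1)) (h2 : Module.finrank ℚ (Kf i₀) = 2)
    (hdeg : ∀ m : Fin r, Module.finrank ℚ (Kf (is m)) = 10) (iK : ∀ i : I, Kf i₀ →+* Kf i)
    (hA : ∀ j, IsCMTypeRealisation (Φ j) (A j) (ι j) (θ j)) (hΨ : ∀ σ : Kf i₀ →+* ℂ, σ ∈ (Φ 0).1 ↔ σ = τ)
    (h23 : ∀ m : Fin r, (Finset.univ.filter fun s : Kf (is m) →+* ℂ => s.comp (iK (is m)) = τ ∧ s ∈ (Φ m.succ).1).card = 2)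
    (hfib : ∀ m : Fin r, (Finset.univ.filter fun m' : Fin r => is m' = is m).card ≤ 2)
    (h20 : ∀ m : Fin r, Module.finrank ℚ ↥(normalClosure ℚ (Kf (is m)) ℂ) ≤ 20)
    (hns : ∀ m : Fin r, ∃ s₀ t₀ : Kf (is m) →+* ℂ, s₀.comp (iK (is m)) = τ ∧ t₀.comp (iK (is m)) = τ ∧ ∃ x, t₀ x ∉ adjoin ℚ (Set.range s₀))
    (hfree : ∀ (m : Fin r) (ρ : ℂ ≃+* ℂ), (ρ : ℂ →+* ℂ).comp τ = τ →
      (∀ m', is m' = is m → ∀ s : Kf (is m') →+* ℂ, s.comp (iK (is m')) = τ → (s ∈ (Φ m'.succ).1 ↔ (ρ : ℂ →+* ℂ).comp s ∈ (Φ m'.succ).1)) →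
      ∀ s : Kf (is m) →+* ℂ, s.comp (iK (is m)) = τ → (ρ : ℂ →+* ℂ).comp s = s)
    (hiso : ∀ m₀ m : Fin r, is m ≠ is m₀ → IsEmpty (Kf (is m) →+* Kf (is m₀)))
    {X : AbelianVariety ℂ} (hX : Domination.AVDominatedBy X (⨁ fun j => A (κ j))) : HodgeConjectureFor X.dim X.X :=
  Domination.hodgeConjectureFor_of_avDominatedBy
    (hodgeConjectureFor_biproduct_comp_of_dihedralDecics hM6 κ h2 hdeg iK hA hΨ h23 hfib h20 hns hfree hiso) hX

/-! ## The menu with freeness asked only of the fields carrying two structures -/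

/-- **THE SAME MENU WITH FREENESS ASKED ONLY OF THE FIELDS CARRYING TWO STRUCTURES** — the form to use.  CORRECTION of the informal remark «for one type: automatic» in the module
docstring: for a slot ALONE over its (dihedral) field the hypothesis `hfree` of `hodgeConjectureFor_biproduct_comp_of_dihedralDecics` is UNSATISFIABLE (the axis reflection of the
type is a non-identity element of the image stabilising it), so that theorem silently excludes single structures; here `hfree m` is asked only when another slot shares the index of
`m` — single structures over dihedral (indeed any) decic fields are prime slots and need nothing.  Same proof. [cite: Markman2025SecantWeil, Thm 1.5.1]
[cite: Shimura1998, §6.1 Corollary of Theorem 2, §8.4, §18.2] [cite: DixonMortimer1996, §1.4 Ex. 1.4.1–1.4.2; §1.6, Thm. 1.6A; §2.1; §3.3] [cite: Serre1977, §5.3] [cite: Lang2002, VI §1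
Thm. 1.1; XIII §4] -/
theorem hodgeConjectureFor_biproduct_comp_of_dihedralDecics' (hM6 : Markman2025_weilClasses_algebraic_hyperbolicSixfold)
    {N : ℕ} (κ : Fin N → Fin (r + 1)) (h2 : Module.finrank ℚ (Kf i₀) = 2)
    (hdeg : ∀ m : Fin r, Module.finrank ℚ (Kf (is m)) = 10) (iK : ∀ i : I, Kf i₀ →+* Kf i)
    (hA : ∀ j, IsCMTypeRealisation (Φ j) (A j) (ι j) (θ j)) (hΨ : ∀ σ : Kf i₀ →+* ℂ, σ ∈ (Φ 0).1 ↔ σ = τ)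
    (h23 : ∀ m : Fin r, (Finset.univ.filter fun s : Kf (is m) →+* ℂ => s.comp (iK (is m)) = τ ∧ s ∈ (Φ m.succ).1).card = 2)
    (hfib : ∀ m : Fin r, (Finset.univ.filter fun m' : Fin r => is m' = is m).card ≤ 2)
    (h20 : ∀ m : Fin r, Module.finrank ℚ ↥(normalClosure ℚ (Kf (is m)) ℂ) ≤ 20)
    (hns : ∀ m : Fin r, ∃ s₀ t₀ : Kf (is m) →+* ℂ, s₀.comp (iK (is m)) = τ ∧ t₀.comp (iK (is m)) = τ ∧ ∃ x, t₀ x ∉ adjoin ℚ (Set.range s₀))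
    (hfree : ∀ m : Fin r, (∃ m', m' ≠ m ∧ is m' = is m) → ∀ ρ : ℂ ≃+* ℂ, (ρ : ℂ →+* ℂ).comp τ = τ →
      (∀ m', is m' = is m → ∀ s : Kf (is m') →+* ℂ, s.comp (iK (is m')) = τ → (s ∈ (Φ m'.succ).1 ↔ (ρ : ℂ →+* ℂ).comp s ∈ (Φ m'.succ).1)) →
      ∀ s : Kf (is m) →+* ℂ, s.comp (iK (is m)) = τ → (ρ : ℂ →+* ℂ).comp s = s)
    (hiso : ∀ m₀ m : Fin r, is m ≠ is m₀ → IsEmpty (Kf (is m) →+* Kf (is m₀))) :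
    HodgeConjectureFor (⨁ fun j => A (κ j)).dim (⨁ fun j => A (κ j)).X := by
  have hττ : ComplexEmbedding.conjugate τ ≠ τ := QuarticCM.conjugate_ne τ
  have hk : ∀ σ : Kf i₀ →+* ℂ, σ = τ ∨ σ = ComplexEmbedding.conjugate τ := fun σ => QuarticCM.eq_or_eq_conjugate_of_quadratic h2 τ σ
  obtain ⟨δ₀, d, hd, hδ₀⟩ := CyclicSextic.exists_sq_eq_neg_nat_of_isTotallyComplex (Kf i₀) h2
  obtain ⟨δ, hδ, hτ⟩ := OcticCurveFourfold.exists_delta_of_mem h2 hd hδ₀ τ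
  let im : ∀ m : Fin r, Kf i₀ →+* Kf (is m) := fun m => iK (is m)
  have hdeg' : ∀ m : Fin r, Module.finrank ℚ (Kf (is m)) = 2 * 5 := fun m => by rw [hdeg m]
  -- (1) the units: a representative map for the fibres of `is`
  obtain ⟨U, hU⟩ := exists_unitRep is
  have hcardU : ∀ m, Fintype.card {m' : Fin r // U m' = U m} = (Finset.univ.filter fun m' : Fin r => is m' = is m).card := fun m => by
    rw [Fintype.card_subtype]; exact congrArg Finset.card (Finset.ext fun x => by simp only [Finset.mem_filter, Finset.mem_univ, true_and, hU])
  -- (2) ONE SIGN FRAME PER INDEX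
  have hfr : ∀ i : I, Module.finrank ℚ (Kf i) = 2 * 5 → ∃ E : (Kf i →+* ℂ) ≃ Fin 5 × Bool,
      (∀ s, (E s).2 = true ↔ s.comp (iK i) = τ) ∧ ∀ s, E (ComplexEmbedding.conjugate s) = ((E s).1, !(E s).2) := fun i hdi => exists_signFrame hdi h2 (iK i) hττ hk
  choose E hE_sign hE_conj using hfr
  have diagT : ∀ i j : I, ∀ h : i = j, ∀ (hi : Module.finrank ℚ (Kf i) = 2 * 5) (hj : Module.finrank ℚ (Kf j) = 2 * 5) (ρ : ℂ →+* ℂ) (a x y : Fin 5),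
      ρ.comp ((E i hi).symm (a, true)) = (E i hi).symm (x, true) → ρ.comp ((E j hj).symm (a, true)) = (E j hj).symm (y, true) → x = y := by
    intro i j h; subst h; intro hi hj ρ a x y h₁ h₂
    exact congrArg Prod.fst ((E i hi).symm.injective (h₁.symm.trans h₂))
  -- (3) the frames of the slots, their readings and position sets (all of size `5`)
  let e : ∀ m : Fin r, (Kf (is m) →+* ℂ) ≃ Fin 5 × Bool := fun m => E (is m) (hdeg' m)
  have he_sign : ∀ (m : Fin r) (s : Kf (is m) →+* ℂ), (e m s).2 = true ↔ s.comp (im m) = τ := fun m => hE_sign (is m) (hdeg' m)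
  have he_conj : ∀ (m : Fin r) (s : Kf (is m) →+* ℂ), e m (ComplexEmbedding.conjugate s) = ((e m s).1, !(e m s).2) := fun m => hE_conj (is m) (hdeg' m)
  let P : ∀ _ : Fin r, Finset (Fin 5) := fun m => Finset.univ.filter fun a : Fin 5 => (e m).symm (a, true) ∈ (Φ m.succ).1
  have hΦ : ∀ (m : Fin r) (s : Kf (is m) →+* ℂ), s ∈ (Φ m.succ).1 ↔ (e m s).2 = decide ((e m s).1 ∈ P m) := fun m s =>
    mem_iff_snd_eq_decide_mem_posSet (he_conj m) (Φ m.succ) s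
  have hcard : ∀ m : Fin r, (P m).card = 2 := fun m => (card_posSet (he_sign m) (Φ m.succ)).trans (h23 m)
  have hmemP : ∀ (m : Fin r) (a : Fin 5), a ∈ P m ↔ (e m).symm (a, true) ∈ (Φ m.succ).1 := fun m a => by
    simp only [P, Finset.mem_filter, Finset.mem_univ, true_and]
  have hsymm_sign : ∀ (m : Fin r) (a : Fin 5), ((e m).symm (a, true)).comp (im m) = τ := fun m a => (he_sign m _).1 (by simp)
  -- (4) the realised tuples are DIAGONAL on every unit
  have hn : ∀ m m' : Fin r, U m' = U m → (5 : ℕ) = 5 := fun _ _ _ => rfl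
  have hdg0 : ∀ π ∈ realisedTuples e τ, ∀ (m m' : Fin r), U m' = U m → ∀ a : Fin 5, π m' a = π m a := by
    intro π hπ m m' h a; obtain ⟨ρ, -, hρ⟩ := (mem_realisedTuples e τ π).1 hπ
    exact diagT _ _ ((hU m m').1 h) (hdeg' m') (hdeg' m) (ρ : ℂ →+* ℂ) a (π m' a) (π m a) (hρ m' a) (hρ m a)
  have hdg : ∀ π ∈ realisedTuples e τ, ∀ (m m' : Fin r) (h : U m' = U m) (a : Fin 5), Fin.cast (hn m m' h) (π m' a) = π m (Fin.cast (hn m m' h) a) := by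
    intro π hπ m m' h a
    have e1 : Fin.cast (hn m m' h) (π m' a) = π m' a := Fin.ext rfl
    have e2 : Fin.cast (hn m m' h) a = a := Fin.ext rfl
    rw [e1, e2]; exact hdg0 π hπ m m' h a
  -- (5) stabiliser-transitivity across units: `Hom = ∅` between different decic fields gives a value outside the closure; prime size `5`
  have hexs : ∀ m : Fin r, ∃ s : Kf (is m) →+* ℂ, s.comp (im m) = τ := fun m => by
    obtain ⟨s₀, -, hs₀, -, -⟩ := hns m; exact ⟨s₀, hs₀⟩
  have hout : ∀ m₀ m : Fin r, is m ≠ is m₀ → ∃ s : Kf (is m) →+* ℂ, s.comp (im m) = τ ∧ ∃ x, s x ∉ normalClosure ℚ (Kf (is m₀)) ℂ := by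
    intro m₀ m hne; obtain ⟨s, hs⟩ := hexs m
    exact ⟨s, hs, exists_apply_not_mem_normalClosure_of_isEmpty_ringHom_five h2 im (hdeg m₀) (hdeg m) (hiso m₀ m hne) s hs⟩
  have hstab₀ : ∀ (m₀ m : Fin r), is m ≠ is m₀ → ∀ a a' : Fin 5, ∃ ν ∈ realisedTuples e τ, ν m₀ = 1 ∧ ν m a = a' := fun m₀ m hne a a' =>
    stabTransitive_realisedTuples_of_outside_prime (e := e) he_sign m₀ m Nat.prime_five (hout m₀ m hne) a a'
  have hstab : ∀ (m₀ m : Fin r), U m₀ ≠ U m → ∀ a a' : Fin 5, ∃ ν ∈ realisedTuples e τ, (∀ m', U m' = U m₀ → ν m' = 1) ∧ ν m a = a' := by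
    intro m₀ m hne a a'
    obtain ⟨ν, hν, hν0, hνa⟩ := hstab₀ m₀ m (fun h => hne ((hU m m₀).2 h.symm)) a a'
    refine ⟨ν, hν, fun m' hm' => Equiv.ext fun b => ?_, hνa⟩
    have hb := hdg0 ν hν m₀ m' hm' b
    rw [hν0] at hb
    exact hb
  -- (6) the slot menu on the single slots: prime size
  have hkind : ∀ m : Fin r, (∀ m', U m' = U m → m' = m) → (5 : ℕ).Prime ∨ (2 : ℕ) = 1 ∨
      ∀ Q : Finset (Fin 5), Q.card = 2 → ∃ π ∈ realisedTuples e τ, preG (π m) (P m) = Q := fun m _ => Or.inl Nat.prime_five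
  -- (7) THE SEPARATION PROPERTY OF EVERY UNIT WITH TWO SLOTS: the dihedral unit
  have hunit : ∀ m, (∃ m', m' ≠ m ∧ U m' = U m) → ∀ (u : {m' : Fin r // U m' = U m} → Fin 5 → ℤ) (w : ℤ),
      (∀ π ∈ realisedTuples e τ, (∑ i, ∑ x : Fin 5, (if π m x ∈ (P i.1).image (Fin.cast (hn m i.1 i.2)) then u i x else -u i x)) = w) →
      ∀ (i : {m' : Fin r // U m' = U m}) (a b : Fin 5), u i a = u i b := by
    intro m hm u w hw
    have hm' : ∃ m', m' ≠ m ∧ is m' = is m := by obtain ⟨m', h1, h2⟩ := hm; exact ⟨m', h1, (hU m m').1 h2⟩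
    have hix : ∀ x : {x : Fin r // U x = U m}, is x.1 = is m := fun x => (hU m x.1).1 x.2
    have hι : Fintype.card {m' : Fin r // U m' = U m} ≤ 2 := by rw [hcardU m]; exact hfib m
    have hQcard : ∀ i : {m' : Fin r // U m' = U m}, ((P i.1).image (Fin.cast (hn m i.1 i.2))).card = 2 := fun i => by
      rw [Finset.card_image_of_injective _ (Fin.cast_injective _), hcard]
    have hmemQ : ∀ (i : {m' : Fin r // U m' = U m}) (y : Fin 5), y ∈ (P i.1).image (Fin.cast (hn m i.1 i.2)) ↔ y ∈ P i.1 := fun i y => by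
      rw [image_cast_self]
    -- freeness, read on the realised tuples
    have hfreeR : ∀ π ∈ realisedTuples e τ, (∀ (i : {m' : Fin r // U m' = U m}) (y : Fin 5), π m y ∈ (P i.1).image (Fin.cast (hn m i.1 i.2)) ↔
        y ∈ (P i.1).image (Fin.cast (hn m i.1 i.2))) → π m = 1 := by
      intro π hπ hst
      obtain ⟨ρ, hρτ, hρ⟩ := (mem_realisedTuples e τ π).1 hπ
      have hfix := hfree m hm' ρ hρτ (fun m' hm' s hs => by
        have hUm' : U m' = U m := (hU m m').2 hm'
        set a : Fin 5 := (e m' s).1 with ha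
        have hs' : (e m').symm (a, true) = s := by
          rw [ha, show ((e m' s).1, true) = e m' s from Prod.ext rfl ((he_sign m' s).2 hs).symm, Equiv.symm_apply_apply]
        have hρs : (ρ : ℂ →+* ℂ).comp s = (e m').symm (π m' a, true) := by rw [← hs']; exact hρ m' a
        have h1 : s ∈ (Φ m'.succ).1 ↔ a ∈ P m' := by rw [hmemP, hs']
        have h2' : (ρ : ℂ →+* ℂ).comp s ∈ (Φ m'.succ).1 ↔ π m' a ∈ P m' := by rw [hmemP, hρs]
        rw [h1, h2']
        have := hst ⟨m', hUm'⟩ a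
        rw [hmemQ, hmemQ, ← hdg0 π hπ m m' hUm' a] at this
        exact this.symm)
      refine Equiv.ext fun y => ?_
      have hy := hfix ((e m).symm (y, true)) (hsymm_sign m y)
      rw [hρ m y] at hy
      exact congrArg Prod.fst ((e m).symm.injective hy)
    exact const_of_signed_realisedTuples_of_dihedral (e := e) he_sign m rfl h2 (h20 m) (hns m) hι
      (fun i => (P i.1).image (Fin.cast (hn m i.1 i.2))) hQcard hfreeR u hw
  -- (8) the engine with separated units; the single-slot Weil spaces from Markman's sixfold theorem
  exact hodgeConjectureFor_biproduct_comp_of_unitsSeparated_frames (is := is) (n := fun _ => 5) P (fun _ => 2) hcard (fun _ => by norm_num) (fun _ => by norm_num)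
    κ h2 im hτ hA e he_sign he_conj hΨ hΦ U hn hdg hstab hunit hkind
    fun m => weilHyp_of_markman_sixfold_decic_intrinsic hM6 m (hdeg m) h2 hd hδ hA hΨ (h23 m)

/-- **Dominated form** of the primed menu. [cite: Markman2025SecantWeil, Thm 1.5.1] [cite: MumfordAV1970, §19 Thm. 1 and p. 169] -/
theorem hodgeConjectureFor_of_avDominatedBy_comp_of_dihedralDecics' (hM6 : Markman2025_weilClasses_algebraic_hyperbolicSixfold)
    {N : ℕ} (κ : Fin N → Fin (r + 1)) (h2 : Module.finrank ℚ (Kf i₀) = 2)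
    (hdeg : ∀ m : Fin r, Module.finrank ℚ (Kf (is m)) = 10) (iK : ∀ i : I, Kf i₀ →+* Kf i)
    (hA : ∀ j, IsCMTypeRealisation (Φ j) (A j) (ι j) (θ j)) (hΨ : ∀ σ : Kf i₀ →+* ℂ, σ ∈ (Φ 0).1 ↔ σ = τ)
    (h23 : ∀ m : Fin r, (Finset.univ.filter fun s : Kf (is m) →+* ℂ => s.comp (iK (is m)) = τ ∧ s ∈ (Φ m.succ).1).card = 2)
    (hfib : ∀ m : Fin r, (Finset.univ.filter fun m' : Fin r => is m' = is m).card ≤ 2)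
    (h20 : ∀ m : Fin r, Module.finrank ℚ ↥(normalClosure ℚ (Kf (is m)) ℂ) ≤ 20)
    (hns : ∀ m : Fin r, ∃ s₀ t₀ : Kf (is m) →+* ℂ, s₀.comp (iK (is m)) = τ ∧ t₀.comp (iK (is m)) = τ ∧ ∃ x, t₀ x ∉ adjoin ℚ (Set.range s₀))
    (hfree : ∀ m : Fin r, (∃ m', m' ≠ m ∧ is m' = is m) → ∀ ρ : ℂ ≃+* ℂ, (ρ : ℂ →+* ℂ).comp τ = τ →
      (∀ m', is m' = is m → ∀ s : Kf (is m') →+* ℂ, s.comp (iK (is m')) = τ → (s ∈ (Φ m'.succ).1 ↔ (ρ : ℂ →+* ℂ).comp s ∈ (Φ m'.succ).1)) →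
      ∀ s : Kf (is m) →+* ℂ, s.comp (iK (is m)) = τ → (ρ : ℂ →+* ℂ).comp s = s)
    (hiso : ∀ m₀ m : Fin r, is m ≠ is m₀ → IsEmpty (Kf (is m) →+* Kf (is m₀)))
    {X : AbelianVariety ℂ} (hX : Domination.AVDominatedBy X (⨁ fun j => A (κ j))) : HodgeConjectureFor X.dim X.X :=
  Domination.hodgeConjectureFor_of_avDominatedBy
    (hodgeConjectureFor_biproduct_comp_of_dihedralDecics' hM6 κ h2 hdeg iK hA hΨ h23 hfib h20 hns hfree hiso) hX

end DihedralDecics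

end Summit.HodgeConjecture.CorCM.MultiFieldWeil

end
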